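import Literature.MathematicalPhysics.QuantumFieldTheory.Balaban1983to89.B16Ineq382VPrime
import Literature.MathematicalPhysics.QuantumFieldTheory.Balaban1983to89.B15PrelimIntegrations

/-!
# `Balaban1983to89.B15Claim196TreeGauge` — T. Bałaban, *Large field renormalization. I. The basic step of the 𝐑 operation*, Commun. Math. Phys. **122** (1989) 175–202 [Balaban1989LargeFieldI], p. 196: the claim *"We can prove that it satisfies |V′ − 1| < O(1)M²NR_k⁴ε_k on 𝐁₀"* for the fluctuation field `V′ = V″V₀⁻¹` in the tree gauge — PROVED as a model instance (one annulus `P₁∖P₂` of the p. 196 tree gauge)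

statement-level skeleton of published theorems with citation tags; proofs where landed; nothing here is a claim about the Yang–Mills mass gap

PDF held: `paper:balaban1989-cmp122-large-field-i` (journal page = PDF page + 174; pp. 195–196 = PDF pp. 21–22,
render `run/shared/lean/pub/pub-balaban/b2b-balaban-ref1/pages/…1989-cmp122-large-field-I-p022-x2.png` re-read by
the gen-2/3 seats of this unit; text layer re-read for this file: p. 177 = PDF p. 3 (condition (i)), p. 193 = PDF
p. 19, p. 196 = PDF p. 22).

WHAT IS REPRODUCED (mega-formalization `lit-balaban`, HOME `run/shared/lean/pub/lit-balaban/`, Phase-2 seat p26,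
generation 4; SKELETON row **B15.Claim@196** (r12), typed leaf `B15.PrelimIntegrations.IneqV196 dev C M N R_k ε_k
:= dev < C·M²·N·R_k⁴·ε_k` (p239014); referee ref-5).  P. 195, (1.81): *"V″ = V′V₀ on Λ₀"*, `V₀ = M_{𝔅″_k}(U₀)`.
P. 196, verbatim: *"The union of all the contours is a tree graph T on P₁∖P₂ … We fix the gauge putting the bond
variables equal to 1 for bonds belonging to the tree graph. … The regularity conditions for V″, V₀, and the gauge
fixing for V′ introduce restrictions on this field. We can prove that it satisfies |V′ − 1| < O(1)M²NR_k⁴ε_k on 𝐁₀."*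
NO PROOF IS PRINTED ("We can prove that"); the proof below is this seat's, by the mechanism of Lemma 1 of [14] =
[Balaban1985RegularSpaces] (which [Balaban1989LargeFieldII] p. 382 invokes for the same configuration) as kernel-
proved in PART 2 of this unit (`B16Ineq382TreeGauge.norm_bond_sub_one_le`: Stokes / ladder bounds for the loops
`Γ_{y,b₋} ∪ b ∪ Γ_{y,b₊}⁻¹`).

THE MODEL (= the carriers of this unit's PARTS 1–3: `Site (n+3) = ℤ^{n+3}`, the annulus `ann lo hi lo' hi'` =
`P₁∖P₂` with the p. 196 geometry `Geom` and contours `contour lo hi τ x` = `Γ_{y,x}`, gauge function `treeGaugeFn V`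
= `x ↦ V(Γ_{y,x})`, `U1 𝔸`-valued bond fields, the bondwise product `B8Lemma1NonAbelian.mulCfg V′ V₀` = (1.81)
`V″ = V′V₀`, PART 3's `BondsOneAlong` = *"bond variables equal to 1 for bonds belonging to the tree graph"*, PART 1's
`PlaqSmallOn` = plaquettes with four corners in `P₁∖P₂` deviate from `1` by `≤ ε`).  §1 `RegHyp196` = the printed
situation: *"the regularity conditions for V″, V₀"* = `ε″`-small plaquettes of `V″ = V′V₀` and `ε₀`-small plaquettes
of `V₀` on `P₁∖P₂` (PLAQUETTE regularity only — no smallness of the bond variables of `V₀` is assumed, unlike PART 3's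
`FluctHyp`, which serves [Balaban1989LargeFieldII] p. 382 where (1.87) is available), *"and the gauge fixing for V′"*
= `V′ = 1` along every `Γ_{y,x}`.  §2 the proof: with `v(x) = V₀(Γ_{y,x})` (`= V″(Γ_{y,x})`, PART 3's
`hol_mulCfg_eq_of_bondsOneAlong`), BOTH gauge-fixed fields `V″^v` and `V₀^v` satisfy PART 2's `Case1Hyp` (`RegHyp196.
case1Hyp_fluct''`, `RegHyp196.case1Hyp_background`), hence `‖V″^v(b) − 1‖ ≤ (5W² + dW)ε″` and `‖V₀^v(b) − 1‖ ≤ (5W² +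
dW)ε₀`; the algebraic identity `V′(b) = v(b₋)⁻¹·[V″^v(b)·(V₀^v(b))⁻¹]·v(b₋)` (`fluct_eq_conj`); so (**`RegHyp196.
norm_fluct_sub_one_le`**) `‖V′(b) − 1‖ ≤ (5W² + dW)(ε″ + ε₀)` for every bond `b` with both ends in `P₁∖P₂` (`W + 1` =
sites per side of `P₁`, `d = n + 3`); the strict printed-style shape `RegHyp196.norm_fluct_sub_one_lt` (`< 6D²(ε″ +
ε₀)` for sides of `≤ D` sites, `d ≤ D`); and §3 the DICTIONARY to the typed row: **`RegHyp196.ineqV196`** =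
`B15.PrelimIntegrations.IneqV196 ‖V′(b) − 1‖ (60000·K) M N R_k ε_k` BY NAME, under `D = 100MR_k` (condition (i) of
p. 177: *"it is contained in a cube of the size 100MR_k"*) and the packaging hypothesis `ε″ + ε₀ ≤ K·N·R_k²·ε_k`,
`0 < K`, for the two regularity inputs (p. 193: *"the functions χ_k(Ω_k^{~4}), χ″_k restrict the field variables V_k
on Ω_k, e.g., |∂V_k − 1| < 2L²N₀ε_k < 2L(L + 1)N^{β₁}R_kε_k"*; (1.80) and [Balaban1985Averaging] Prop. 1 for `V₀ =
M(U₀)`), whose printed constants the row's `O(1)` absorbs.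

HONEST SCOPE / DEVIATIONS.  (1) MODEL INSTANCE: one rectangular annulus `P₁∖P₂ ⊂ ℤ^{n+3}` (`d = n + 3 ≥ 3`; the print
has `d = 4`) of the nested family of p. 195, `P₂` strictly inside `P₁` in every direction (`Geom`), bonds with BOTH
ends in `P₁∖P₂`; the bonds of `𝐁₀` joining two annuli of different scales (p. 196: *"they are bonds of the larger
scale"*) and the external bonds of `T₀` are not modelled (as in `B15TreeGauge196`; r12's `B15TreeGraph196` §8 has the
single-scale `T₀`).  (2) `U1 𝔸`-valued fields (`⊇ U(N)`), `≤`-hypotheses, operator norm.  (3) The constant: the proof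
gives `(5W² + dW)(ε″ + ε₀) < 6(100MR_k)²(ε″ + ε₀)`; the printed `O(1)M²NR_k⁴ε_k` is met under the packaging hypothesis
of §3 (the typed leaf has `O(1) = C` free; here `C = 60000·K`).  Nothing is weakened: the typed leaf is discharged AS
TYPED for the model's `dev = ‖V′(b) − 1‖`.  Every declaration is a definition with a body or a proved theorem; nothing
of [IV] is asserted as a hypothesis-free fact.  Unit `lit-balaban-p26` (literature-prover-lit-balaban-p26-g4-0).
-/

noncomputable section

open scoped BigOperators

namespace Literature.MathematicalPhysics.QuantumFieldTheory.Balaban1983to89.B15TreeGauge196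

open B7Prop1Explicit B8Lemma1NonAbelian B16Ineq382

variable {n : ℕ} {𝔸 : Type*} [NormedRing 𝔸] [NormOneClass 𝔸]

/-! ## §1 The situation of p. 196 (regularity of `V″`, `V₀`; tree gauge for `V′`) -/

/-- **[IV] p. 196: "The regularity conditions for V″, V₀, and the gauge fixing for V′"** on one annulus `P₁∖P₂ =
ann lo hi lo' hi'` of `ℤ^{n+3}` in the variables of (1.81) `V″ = V′V₀`: the p. 196 geometry (`Geom`), sides of `P₁`
of at most `W + 1` sites, `U1`-valued `V′`, `V₀`; the plaquettes of `V″ = V′V₀` with corners in `P₁∖P₂` deviate from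
`1` by `≤ ε″` and those of `V₀` by `≤ ε₀` (the two regularity conditions); and the tree gauge: the bond variables of
`V′` equal `1` along every contour `Γ_{y,x}`, `x ∈ P₁∖P₂`. [cite: Balaban1989LargeFieldI, p.196 (bound on V′)] -/
structure RegHyp196 (lo hi lo' hi' : Site (n + 3)) (τ : ℤ) (W : ℕ) (V' V₀ : Site (n + 3) → Fin (n + 3) → 𝔸ˣ)
    (ε'' ε₀ : ℝ) : Prop where
  geom : Geom lo hi lo' hi' τ
  width : ∀ κ, hi κ - lo κ ≤ W
  unit' : ∀ x κ, V' x κ ∈ U1 𝔸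
  unit₀ : ∀ x κ, V₀ x κ ∈ U1 𝔸
  eps''_nonneg : 0 ≤ ε''
  eps₀_nonneg : 0 ≤ ε₀
  plaq'' : B16Ineq382.PlaqSmallOn (ann lo hi lo' hi') (mulCfg V' V₀) ε''
  plaq₀ : B16Ineq382.PlaqSmallOn (ann lo hi lo' hi') V₀ ε₀
  tree : ∀ x ∈ ann lo hi lo' hi', BondsOneAlong V' lo (contour lo hi τ x)

variable {lo hi lo' hi' : Site (n + 3)} {τ : ℤ} {W : ℕ} {V' V₀ : Site (n + 3) → Fin (n + 3) → 𝔸ˣ} {ε'' ε₀ : ℝ}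

/-! ## §2 The proof: both gauge-fixed fields `V″^v`, `V₀^v`, `v(x) = V₀(Γ_{y,x})`, are controlled by PART 2 -/

/-- The gauge function built from `V″ = V′V₀` IS the one built from `V₀`: `V″(Γ_{y,x}) = V₀(Γ_{y,x})` for `x ∈ P₁∖P₂`
(the tree gauge kills `V′` along the contour; [V] p. 381 *"v is determined by V₀ only"*). [cite: Balaban1989LargeFieldI, p.196 (bound on V′)] -/
theorem RegHyp196.treeGaugeFn_mulCfg (H : RegHyp196 lo hi lo' hi' τ W V' V₀ ε'' ε₀) {x : Site (n + 3)}
    (hx : x ∈ ann lo hi lo' hi') : treeGaugeFn (mulCfg V' V₀) lo hi τ x = treeGaugeFn V₀ lo hi τ x :=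
  hol_mulCfg_eq_of_bondsOneAlong (H.tree x hx)

/-- `V″^v`, `v(x) = V₀(Γ_{y,x})`, satisfies PART 2's `Case1Hyp` with `ε″` (its plaquettes are conjugates of those of
`V″`; `V″^v(Γ_{y,x}) = v(y)V″(Γ_{y,x})v(x)⁻¹ = V₀(Γ_{y,x})V₀(Γ_{y,x})⁻¹ = 1`). [cite: Balaban1989LargeFieldI, p.196 (bound on V′)] -/
theorem RegHyp196.case1Hyp_fluct'' (H : RegHyp196 lo hi lo' hi' τ W V' V₀ ε'' ε₀) :
    Case1Hyp lo hi lo' hi' τ W (gaugeAct (treeGaugeFn V₀ lo hi τ) (mulCfg V' V₀)) ε'' where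
  geom := H.geom
  width := H.width
  unit := gaugeAct_mem (mulCfg_mem H.unit' H.unit₀) fun _ => hol_mem H.unit₀ _ _
  eps_nonneg := H.eps''_nonneg
  plaq := H.plaq''.gaugeAct fun _ => hol_mem H.unit₀ _ _
  gauge := fun x hx => by
    rw [hol_gaugeAct, disp_contour, add_sub_cancel, hol_mulCfg_eq_of_bondsOneAlong (H.tree x hx), treeGaugeFn,
      treeGaugeFn, contour_self H.geom.lo_le_tau, hol_nil, one_mul, mul_inv_cancel]

/-- `V₀^v`, `v(x) = V₀(Γ_{y,x})`, satisfies PART 2's `Case1Hyp` with `ε₀` (PART 2's `case1Hyp_gaugeFixed` for the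
field `V₀` itself). [cite: Balaban1989LargeFieldI, p.196 (bound on V′)] -/
theorem RegHyp196.case1Hyp_background (H : RegHyp196 lo hi lo' hi' τ W V' V₀ ε'' ε₀) :
    Case1Hyp lo hi lo' hi' τ W (gaugeAct (treeGaugeFn V₀ lo hi τ) V₀) ε₀ :=
  case1Hyp_gaugeFixed H.geom H.width H.unit₀ H.eps₀_nonneg H.plaq₀

/-- PART 2's bound for `V″^v`: `‖V″^v(b) − 1‖ ≤ (5W² + dW)ε″` on the bonds of `P₁∖P₂`. [cite: Balaban1989LargeFieldI, p.196 (bound on V′)] -/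
theorem RegHyp196.norm_fluct''_fixed_sub_one_le (H : RegHyp196 lo hi lo' hi' τ W V' V₀ ε'' ε₀) {x : Site (n + 3)}
    {μ : Fin (n + 3)} (hx : x ∈ ann lo hi lo' hi') (hx' : x + e μ ∈ ann lo hi lo' hi') :
    ‖((gaugeAct (treeGaugeFn V₀ lo hi τ) (mulCfg V' V₀) x μ : 𝔸ˣ) : 𝔸) - 1‖ ≤
      (5 * (W : ℝ) ^ 2 + (n + 3) * W) * ε'' :=
  norm_bond_sub_one_le H.case1Hyp_fluct'' hx hx'

/-- PART 2's bound for `V₀^v`: `‖V₀^v(b) − 1‖ ≤ (5W² + dW)ε₀` on the bonds of `P₁∖P₂`. [cite: Balaban1989LargeFieldI, p.196 (bound on V′)] -/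
theorem RegHyp196.norm_background_fixed_sub_one_le (H : RegHyp196 lo hi lo' hi' τ W V' V₀ ε'' ε₀)
    {x : Site (n + 3)} {μ : Fin (n + 3)} (hx : x ∈ ann lo hi lo' hi') (hx' : x + e μ ∈ ann lo hi lo' hi') :
    ‖((gaugeAct (treeGaugeFn V₀ lo hi τ) V₀ x μ : 𝔸ˣ) : 𝔸) - 1‖ ≤ (5 * (W : ℝ) ^ 2 + (n + 3) * W) * ε₀ :=
  norm_bond_sub_one_le H.case1Hyp_background hx hx'

/-- **The algebra of the proof**: for any gauge function `v` and bond `b = ⟨x, x + e_μ⟩`,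
`V′(b) = v(x)⁻¹ · [(V′V₀)^v(b) · (V₀^v(b))⁻¹] · v(x)` — the fluctuation field is a conjugate of the quotient of the
two gauge-fixed bond variables. [cite: Balaban1989LargeFieldI, p.196 (bound on V′)] -/
theorem fluct_eq_conj {G : Type*} [Group G] (v : Site (n + 3) → G) (V' V₀ : Site (n + 3) → Fin (n + 3) → G)
    (x : Site (n + 3)) (μ : Fin (n + 3)) :
    V' x μ = (v x)⁻¹ * (gaugeAct v (mulCfg V' V₀) x μ * (gaugeAct v V₀ x μ)⁻¹) * v x := by
  simp only [gaugeAct, mulCfg]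
  group

/-- **[IV] p. 196, the claim "|V′ − 1| < O(1)M²NR_k⁴ε_k on 𝐁₀", object level** (model instance, explicit
constant): in the situation `RegHyp196`, every bond `b = ⟨x, x + e_μ⟩` with both ends in `P₁∖P₂` satisfies
`‖V′(b) − 1‖ ≤ (5W² + dW)(ε″ + ε₀)` (`W + 1` = sites per side of `P₁`, `d = n + 3`).  Proof: `fluct_eq_conj` with
`v(x) = V₀(Γ_{y,x})`, conjugation by the `U1` element `v(x)` does not increase `‖· − 1‖`, `‖AB⁻¹ − 1‖ ≤ ‖A − 1‖ +
‖B⁻¹ − 1‖ ≤ ‖A − 1‖ + ‖B − 1‖` in `U1`, and the two PART-2 bounds. [cite: Balaban1989LargeFieldI, p.196 (bound on V′)] -/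
theorem RegHyp196.norm_fluct_sub_one_le (H : RegHyp196 lo hi lo' hi' τ W V' V₀ ε'' ε₀) {x : Site (n + 3)}
    {μ : Fin (n + 3)} (hx : x ∈ ann lo hi lo' hi') (hx' : x + e μ ∈ ann lo hi lo' hi') :
    ‖((V' x μ : 𝔸ˣ) : 𝔸) - 1‖ ≤ (5 * (W : ℝ) ^ 2 + (n + 3) * W) * (ε'' + ε₀) := by
  set v := treeGaugeFn V₀ lo hi τ with hv
  have hvU : ∀ z, v z ∈ U1 𝔸 := fun z => hol_mem H.unit₀ _ _
  set A := gaugeAct v (mulCfg V' V₀) x μ with hA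
  set B := gaugeAct v V₀ x μ with hB
  have hAU : A ∈ U1 𝔸 := H.case1Hyp_fluct''.unit x μ
  have hBU : B ∈ U1 𝔸 := H.case1Hyp_background.unit x μ
  have hAle : ‖(A : 𝔸) - 1‖ ≤ (5 * (W : ℝ) ^ 2 + (n + 3) * W) * ε'' := H.norm_fluct''_fixed_sub_one_le hx hx'
  have hBle : ‖(B : 𝔸) - 1‖ ≤ (5 * (W : ℝ) ^ 2 + (n + 3) * W) * ε₀ := H.norm_background_fixed_sub_one_le hx hx'
  -- `‖B⁻¹ − 1‖ ≤ ‖B − 1‖`, `‖A B⁻¹ − 1‖ ≤ ‖A − 1‖ + ‖B⁻¹ − 1‖`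
  have hBinv : ‖((B⁻¹ : 𝔸ˣ) : 𝔸) - 1‖ ≤ ‖(B : 𝔸) - 1‖ := norm_inv_sub_one_le hBU
  have hAB : ‖((A * B⁻¹ : 𝔸ˣ) : 𝔸) - 1‖ ≤ ‖(A : 𝔸) - 1‖ + ‖((B⁻¹ : 𝔸ˣ) : 𝔸) - 1‖ :=
    norm_units_mul_sub_one_le hAU
  -- conjugation by `v(x) ∈ U1`
  have hconj : ‖(((v x)⁻¹ : 𝔸ˣ) : 𝔸) * ((A * B⁻¹ : 𝔸ˣ) : 𝔸) * ((v x : 𝔸ˣ) : 𝔸) - 1‖ ≤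
      ‖((A * B⁻¹ : 𝔸ˣ) : 𝔸) - 1‖ := norm_units_inv_conj_sub_one_le (hvU x) _
  have heq : ((V' x μ : 𝔸ˣ) : 𝔸) = (((v x)⁻¹ : 𝔸ˣ) : 𝔸) * ((A * B⁻¹ : 𝔸ˣ) : 𝔸) * ((v x : 𝔸ˣ) : 𝔸) := by
    rw [← Units.val_mul, ← Units.val_mul, ← fluct_eq_conj v V' V₀ x μ]
  rw [heq]
  have hsum : (5 * (W : ℝ) ^ 2 + (n + 3) * W) * ε'' + (5 * (W : ℝ) ^ 2 + (n + 3) * W) * ε₀ =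
      (5 * (W : ℝ) ^ 2 + (n + 3) * W) * (ε'' + ε₀) := by ring
  linarith

/-- **Printed-style strict shape**: with `D ≥ W + 1` sites per side (condition (i) of p. 177: `D = 100MR_k`), `d ≤ D`
and `0 < ε″ + ε₀`, every bond of `P₁∖P₂` has `‖V′(b) − 1‖ < 6D²(ε″ + ε₀)`. [cite: Balaban1989LargeFieldI, p.196 (bound on V′)] -/
theorem RegHyp196.norm_fluct_sub_one_lt (H : RegHyp196 lo hi lo' hi' τ W V' V₀ ε'' ε₀) {D : ℝ}
    (hD : (W : ℝ) + 1 ≤ D) (hd : (n : ℝ) + 3 ≤ D) (hε : 0 < ε'' + ε₀) {x : Site (n + 3)} {μ : Fin (n + 3)}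
    (hx : x ∈ ann lo hi lo' hi') (hx' : x + e μ ∈ ann lo hi lo' hi') :
    ‖((V' x μ : 𝔸ˣ) : 𝔸) - 1‖ < 6 * D ^ 2 * (ε'' + ε₀) := by
  refine (H.norm_fluct_sub_one_le hx hx').trans_lt (mul_lt_mul_of_pos_right ?_ hε)
  have hW : (0 : ℝ) ≤ W := Nat.cast_nonneg W
  have hn : (0 : ℝ) ≤ n := Nat.cast_nonneg n
  have hD0 : (0 : ℝ) ≤ D := by linarith
  have h1 : ((W : ℝ) + 1) * ((W : ℝ) + 1) ≤ D * D := mul_le_mul hD hD (by positivity) hD0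
  have h2 : ((n : ℝ) + 3) * ((W : ℝ) + 1) ≤ D * D := mul_le_mul hd hD (by positivity) hD0
  nlinarith [h1, h2]

/-! ## §3 Dictionary to the typed row `B15.PrelimIntegrations.IneqV196` -/

/-- **The row's typed leaf, discharged by name** for the model: with `D = 100·M·R_k` sites per side (p. 177 (i):
*"it is contained in a cube of the size 100MR_k"*), `d ≤ 100MR_k`, and the two regularity inputs packaged as
`ε″ + ε₀ ≤ K·N·R_k²·ε_k` (`0 < K`; `N ≥ 1` remembered steps, `R_k`, `ε_k > 0`), every bond `b` with both ends in
`P₁∖P₂` satisfies `B15.PrelimIntegrations.IneqV196 ‖V′(b) − 1‖ (60000·K) M N R_k ε_k`, i.e. the printed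
`|V′(b) − 1| < O(1)M²NR_k⁴ε_k` with `O(1) = 6·10⁴·K`. [cite: Balaban1989LargeFieldI, p.196 (bound on V′)] -/
theorem RegHyp196.ineqV196 (H : RegHyp196 lo hi lo' hi' τ W V' V₀ ε'' ε₀) {M Rk N εk K : ℝ}
    (hD : (W : ℝ) + 1 ≤ 100 * M * Rk) (hd : (n : ℝ) + 3 ≤ 100 * M * Rk) (hK : 0 < K) (hN : 1 ≤ N)
    (hRk : 0 < Rk) (hεk : 0 < εk) (hreg : ε'' + ε₀ ≤ K * N * Rk ^ 2 * εk) {x : Site (n + 3)} {μ : Fin (n + 3)}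
    (hx : x ∈ ann lo hi lo' hi') (hx' : x + e μ ∈ ann lo hi lo' hi') :
    B15.PrelimIntegrations.IneqV196 ‖((V' x μ : 𝔸ˣ) : 𝔸) - 1‖ (60000 * K) M N Rk εk := by
  unfold B15.PrelimIntegrations.IneqV196
  have hle := H.norm_fluct_sub_one_le hx hx'
  have hW : (0 : ℝ) ≤ W := Nat.cast_nonneg W
  have hn : (0 : ℝ) ≤ n := Nat.cast_nonneg n
  have hD0 : (0 : ℝ) ≤ 100 * M * Rk := by linarith
  have h1 : ((W : ℝ) + 1) * ((W : ℝ) + 1) ≤ (100 * M * Rk) * (100 * M * Rk) :=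
    mul_le_mul hD hD (by positivity) hD0
  have h2 : ((n : ℝ) + 3) * ((W : ℝ) + 1) ≤ (100 * M * Rk) * (100 * M * Rk) :=
    mul_le_mul hd hD (by positivity) hD0
  -- `5W² + dW < 6(100MR_k)²`
  have hcoef : 5 * (W : ℝ) ^ 2 + (n + 3) * W < 6 * (100 * M * Rk) ^ 2 := by nlinarith [h1, h2]
  have hpos : 0 < K * N * Rk ^ 2 * εk := by positivity
  have hs0 : 0 ≤ ε'' + ε₀ := add_nonneg H.eps''_nonneg H.eps₀_nonneg
  have h3 : (5 * (W : ℝ) ^ 2 + (n + 3) * W) * (ε'' + ε₀) ≤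
      (5 * (W : ℝ) ^ 2 + (n + 3) * W) * (K * N * Rk ^ 2 * εk) :=
    mul_le_mul_of_nonneg_left hreg (by positivity)
  have h4 : (5 * (W : ℝ) ^ 2 + (n + 3) * W) * (K * N * Rk ^ 2 * εk) <
      6 * (100 * M * Rk) ^ 2 * (K * N * Rk ^ 2 * εk) := mul_lt_mul_of_pos_right hcoef hpos
  have h5 : 6 * (100 * M * Rk) ^ 2 * (K * N * Rk ^ 2 * εk) = 60000 * K * M ^ 2 * N * Rk ^ 4 * εk := by ring
  linarith

end Literature.MathematicalPhysics.QuantumFieldTheory.Balaban1983to89.B15TreeGauge196
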